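import Mathlib
import Literature.AlgebraicGeometry.Tropical.TorusCycles
import Summits.HodgeConjecture.HodgeConjecture.Theses.TropicalWeilObstruction
import Summits.HodgeConjecture.HodgeConjecture.Theorems.TropicalWeilObstructionTropicalWeilVanishingIdentityCriterion
import HarnessLib

/-!
# Crux `TropicalWeilVanishing` (stmt-HodgeConjecture-18478): the DECISION CRITERION —
# K1 fails iff ONE finite linear certificate exists on the standard torus `ℝ⁸/ℤ⁸`

Route `TropicalWeilObstruction` of `HodgeConjecture` (a REFUTATION route: a negation sink, no claim on
the Hodge conjecture in either direction is made here). Scope file of the cell `pub-hodge-tropical`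
(K1 = open-problem grade). The tree already proves
`tropicalWeilVanishing_iff_obstructedAtIdentity` (K1 ⟺ every effective tropical `4`-cycle `Z₀` on
`ℝ⁸/ℤ⁸` with `W(Z₀) ≠ 0` is obstructed at the identity) and
`tropicalWeilVanishing_false_of_unobstructedSeed` (an unobstructed seed refutes K1). This file states
the decision problem in closed form:

* `not_tropicalWeilVanishing_iff_exists_unobstructedSeed` — **`¬ K1` ⟺ there is an effective tropical
  `4`-cycle `Z₀` on `ℝ⁸/ℤ⁸` with `W(Z₀) ≠ 0` whose LINEARISED REALISATION SYSTEM (edge equations of its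
  combinatorial type + facet identifications) is solvable in every direction `D` of
  `Sym_J = {D = Dᵀ, DJ = JD}`** (`J = weilJ 4`). So K1 is refuted by, and only by, a seed together with
  real data `(v, T, r)` per direction — when `Z₀` has rational data this is a finite rational
  certificate, checkable by exact linear algebra.
* `not_tropicalWeilVanishing_of_sections_on_spanning_family` — the system is LINEAR in `D`, so
  solvability on any finite family `E₁, …, E_k` spanning `Sym_J` (e.g. the `16` elementary symmetric
  `J`-commuting matrices) suffices: **`¬ K1` follows from `k` solved linear systems**.
* `tropicalWeilVanishing_iff_forall_not_linearlyRealisable` — the positive form: **K1 ⟺ for every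
  effective `W ≠ 0` seed on `ℝ⁸/ℤ⁸` the linearised realisation system is INCONSISTENT in some
  direction of `Sym_J`** (Kontsevich's per-type dual certificate). A proof of K1 is therefore a
  uniform inconsistency theorem over ALL combinatorial types — an infinite family of integer linear
  systems; no finite computation proves K1.

HONEST STATUS. K1 is OPEN (Kontsevich–Zharkov tropical test, `n = 4`); nothing here decides it or
the Hodge conjecture. Mathlib + sibling theorems only; no definition, no named fact, no sorry.

## References

* [Zharkov2020TropicalWeil] I. Zharkov, Tropical abelian varieties, Weil classes and the Hodge
  conjecture, arXiv:2002.02347 (2020), §1–2 (pp. 2–4): Kontsevich's counting scheme and the dual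
  certificate `Φ`.
* [MikhalkinZharkov2014Eigenwave] G. Mikhalkin, I. Zharkov, Tropical eigenwave and intermediate
  Jacobians, LN UMI 15 (2014), Def. 4.2, Prop. 4.3.
-/

-- `Summit.HodgeConjecture.HodgeConjecture.…` is the mandated namespace (single-conjunct summit).
set_option linter.dupNamespace false

noncomputable section

open scoped BigOperators Matrix
open Matrix Literature.AlgebraicGeometry.Tropical

namespace Summit.HodgeConjecture.HodgeConjecture.Theorems.TropicalWeilVanishing

/-- **Decision criterion for K1.** `TropicalWeilVanishing` FAILS iff some effective tropical
`4`-cycle `Z₀` on the standard torus `ℝ⁸/ℤ⁸` with `W(Z₀) ≠ 0` has its linearised realisation system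
solvable in every direction of `Sym_J`: for every symmetric `J`-commuting `D` there are vertices `v`,
edge matrices `T` and reference facets `r` satisfying the edge equations of the type of `Z₀` and the
facet identifications with period `D`. (`←`: `tropicalWeilVanishing_false_of_unobstructedSeed`;
`→`: K1 ⟺ obstruction at the identity, and the dichotomy `obstructed_or_linearSection`.)
[cite: Zharkov2020TropicalWeil, §1–2 (pp. 2–4)] [cite: MikhalkinZharkov2014Eigenwave, Def. 4.2 and Prop. 4.3] -/
theorem not_tropicalWeilVanishing_iff_exists_unobstructedSeed :
    ¬ Theses.TropicalWeilObstruction.TropicalWeilVanishing ↔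
      ∃ Z₀ : TropicalTorusCycle (2 * 4) 4 (1 : Matrix (Fin (2 * 4)) (Fin (2 * 4)) ℝ),
        weilFunctional Z₀ ≠ 0 ∧
        ∀ D : Matrix (Fin (2 * 4)) (Fin (2 * 4)) ℝ, D.IsSymm → D * weilJ 4 = weilJ 4 * D →
          ∃ (v : Fin Z₀.numCells → Fin (4 + 1) → Fin (2 * 4) → ℝ)
            (T : Fin Z₀.numCells → Matrix (Fin 4) (Fin 4) ℝ)
            (r : Fin Z₀.numFacetClasses → Fin 4 → Fin (2 * 4) → ℝ),
            (∀ (σ : Fin Z₀.numCells) (j : Fin 4) (a : Fin (2 * 4)),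
                v σ j.succ a - v σ 0 a = ∑ m, ((Z₀.cell σ).frame a m : ℝ) * T σ m j) ∧
            (∀ (σ : Fin Z₀.numCells) (i : Fin (4 + 1)) (j : Fin 4) (a : Fin (2 * 4)),
                v σ (i.succAbove (Z₀.facetPerm σ i j)) a =
                  r (Z₀.facetClass σ i) j a + ∑ b, D a b * (Z₀.facetShift σ i b : ℝ)) := by
  constructor
  · intro hK
    by_contra hne
    apply hK
    rw [tropicalWeilVanishing_iff_obstructedAtIdentity]
    intro Z₀ hW
    rcases obstructed_or_linearSection Z₀ with h | h
    · exact h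
    · exact absurd ⟨Z₀, hW, h⟩ hne
  · rintro ⟨Z₀, hW, hsec⟩
    exact tropicalWeilVanishing_false_of_unobstructedSeed Z₀ hW hsec

/-- **K1, positive form: every `W ≠ 0` seed is linearly NON-realisable in some Weil direction.**
`TropicalWeilVanishing` holds iff for every effective tropical `4`-cycle `Z₀` on `ℝ⁸/ℤ⁸` with
`W(Z₀) ≠ 0` there is a symmetric `J`-commuting `D` in whose direction the linearised realisation
system of the type of `Z₀` is inconsistent (the per-type dual certificate of Kontsevich's scheme,
pinned at the rational period `1`). A proof of K1 is a UNIFORM inconsistency theorem over all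
combinatorial types. [cite: Zharkov2020TropicalWeil, §1–2 (pp. 2–4)] -/
theorem tropicalWeilVanishing_iff_forall_not_linearlyRealisable :
    Theses.TropicalWeilObstruction.TropicalWeilVanishing ↔
      ∀ Z₀ : TropicalTorusCycle (2 * 4) 4 (1 : Matrix (Fin (2 * 4)) (Fin (2 * 4)) ℝ),
        weilFunctional Z₀ ≠ 0 →
        ∃ D : Matrix (Fin (2 * 4)) (Fin (2 * 4)) ℝ, D.IsSymm ∧ D * weilJ 4 = weilJ 4 * D ∧
          ¬ ∃ (v : Fin Z₀.numCells → Fin (4 + 1) → Fin (2 * 4) → ℝ)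
              (T : Fin Z₀.numCells → Matrix (Fin 4) (Fin 4) ℝ)
              (r : Fin Z₀.numFacetClasses → Fin 4 → Fin (2 * 4) → ℝ),
              (∀ (σ : Fin Z₀.numCells) (j : Fin 4) (a : Fin (2 * 4)),
                  v σ j.succ a - v σ 0 a = ∑ m, ((Z₀.cell σ).frame a m : ℝ) * T σ m j) ∧
              (∀ (σ : Fin Z₀.numCells) (i : Fin (4 + 1)) (j : Fin 4) (a : Fin (2 * 4)),
                  v σ (i.succAbove (Z₀.facetPerm σ i j)) a =
                    r (Z₀.facetClass σ i) j a + ∑ b, D a b * (Z₀.facetShift σ i b : ℝ)) := by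
  rw [← not_iff_not, not_tropicalWeilVanishing_iff_exists_unobstructedSeed]
  push Not
  rfl

/-- **Finitely many directions suffice (linearity in `D`).** Let `Z₀` be an effective tropical
`4`-cycle on `ℝ⁸/ℤ⁸` with `W(Z₀) ≠ 0`, and `E₁, …, E_k` a finite family of `8 × 8` matrices whose
real span contains every symmetric `J`-commuting matrix (e.g. a basis of the `16`-dimensional
`Sym_J`). If the linearised realisation system of the type of `Z₀` is solved in each direction `E_i`,
then it is solvable in every direction of `Sym_J` (superpose the solutions), hence
`TropicalWeilVanishing` fails. This is the finite certificate format for `¬ K1`: `k` linear systems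
with integer coefficients when the `E_i` and the data of `Z₀` are rational.
[cite: Zharkov2020TropicalWeil, §1–2 (pp. 2–4)] [cite: MikhalkinZharkov2014Eigenwave, Def. 4.2 and Prop. 4.3] -/
theorem not_tropicalWeilVanishing_of_sections_on_spanning_family
    (Z₀ : TropicalTorusCycle (2 * 4) 4 (1 : Matrix (Fin (2 * 4)) (Fin (2 * 4)) ℝ))
    (hW : weilFunctional Z₀ ≠ 0)
    {ι : Type*} [Fintype ι] (E : ι → Matrix (Fin (2 * 4)) (Fin (2 * 4)) ℝ)
    (hspan : ∀ D : Matrix (Fin (2 * 4)) (Fin (2 * 4)) ℝ, D.IsSymm → D * weilJ 4 = weilJ 4 * D →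
      D ∈ Submodule.span ℝ (Set.range E))
    (v : ι → Fin Z₀.numCells → Fin (4 + 1) → Fin (2 * 4) → ℝ)
    (T : ι → Fin Z₀.numCells → Matrix (Fin 4) (Fin 4) ℝ)
    (r : ι → Fin Z₀.numFacetClasses → Fin 4 → Fin (2 * 4) → ℝ)
    (hv : ∀ (i : ι) (σ : Fin Z₀.numCells) (j : Fin 4) (a : Fin (2 * 4)),
      v i σ j.succ a - v i σ 0 a = ∑ m, ((Z₀.cell σ).frame a m : ℝ) * T i σ m j)
    (hr : ∀ (i : ι) (σ : Fin Z₀.numCells) (i' : Fin (4 + 1)) (j : Fin 4) (a : Fin (2 * 4)),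
      v i σ (i'.succAbove (Z₀.facetPerm σ i' j)) a =
        r i (Z₀.facetClass σ i') j a + ∑ b, E i a b * (Z₀.facetShift σ i' b : ℝ)) :
    ¬ Theses.TropicalWeilObstruction.TropicalWeilVanishing := by
  classical
  apply tropicalWeilVanishing_false_of_unobstructedSeed Z₀ hW
  intro D hDS hDJ
  obtain ⟨c, hc⟩ := (Submodule.mem_span_range_iff_exists_fun ℝ).1 (hspan D hDS hDJ)
  refine ⟨fun σ j a => ∑ i, c i * v i σ j a, fun σ => ∑ i, c i • T i σ,
    fun f j a => ∑ i, c i * r i f j a, ?_, ?_⟩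
  · intro σ j a
    have e : ∀ m, (∑ i, c i • T i σ) m j = ∑ i, c i * T i σ m j := fun m => by
      simp only [Matrix.sum_apply, Matrix.smul_apply, smul_eq_mul]
    simp_rw [e]
    rw [← Finset.sum_sub_distrib]
    simp_rw [← mul_sub, hv, Finset.mul_sum]
    rw [Finset.sum_comm]
    exact Finset.sum_congr rfl fun m _ => Finset.sum_congr rfl fun i _ => by ring
  · intro σ i' j a
    have eD : ∀ b, D a b = ∑ i, c i * E i a b := fun b => by
      rw [← hc]; simp only [Matrix.sum_apply, Matrix.smul_apply, smul_eq_mul]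
    simp_rw [hr, mul_add, Finset.sum_add_distrib, eD, Finset.sum_mul, Finset.mul_sum]
    congr 1
    rw [Finset.sum_comm]
    exact Finset.sum_congr rfl fun b _ => Finset.sum_congr rfl fun i _ => by ring

end Summit.HodgeConjecture.HodgeConjecture.Theorems.TropicalWeilVanishing

end
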